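import Literature.AlgebraicTopology.SingularHomology.CellsAttachmentHomology
import Literature.AlgebraicTopology.SingularHomology.ClosedBallSphereHomology
import Literature.AlgebraicTopology.SingularHomology.EulerCharacteristicTriple
import Mathlib.LinearAlgebra.Dimension.Localization
import HarnessLib

/-!
# The Euler characteristic of a closed set with finitely many disjoint closed cells attached

Companion of `…CellsAttachmentHomology` (which proves the *vanishing* of
`Hⱼ(S₁ ∪ ⋃ᵢ Φᵢ(D^{dᵢ}), S₁; M)` off the cell dimensions): here the **ranks**.  For a Hausdorff
space `Z`, a closed `S₁ ⊆ Z` and finitely many continuous injections `Φᵢ : D^{dᵢ} → Z` of closed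
unit balls with pairwise disjoint images, each meeting `S₁` exactly along its boundary sphere,
the relative homology `H_•(S₁ ∪ ⋃ᵢ Φᵢ(D^{dᵢ}), S₁; M)` is finitely generated, vanishes above the
top cell dimension, and has Euler characteristic

  `χ(S₁ ∪ ⋃ᵢ Φᵢ(D^{dᵢ}), S₁) = (Σᵢ (-1)^{dᵢ}) · rank_R M`

(`finRelHomology_union_iUnion_range`) — Hatcher, *Algebraic Topology* (2002), Lemma 2.34 (a) with
the proof of Thm. 2.44 (cells attached to a closed set rather than to a skeleton: each cell
contributes `H_•(Dᵏ, ∂Dᵏ; M) = M` in degree `k`, Example 2.17, and the Euler characteristic is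
additive along the exact sequence of the triple `(B ∪ D', B, S₁)`, §2.1 p. 118); this is the rank
statement behind Milnor's Remark after Thm. 3.14 with Cor. 3.15 (*Lectures on the h-cobordism
theorem* (1965), PDF p. 21: *"`H⁎(W, V)` is isomorphic to `ℤ ⊕ … ⊕ ℤ` (`k` summands) in dimension
`λ` and is zero otherwise"*) in the Euler-characteristic form needed for the Morse equalities.

Steps (all proved): contractible spaces (`finRelHomology_empty_of_contractibleSpace`,
`χ = rank M`); the models `(Dᵏ, ∂Dᵏ)` (`nonempty_relativeSingularHomology_closedBall_sphere_equiv :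
H_k(Dᵏ, ∂Dᵏ; M) ≃ₗ[R] M`, `χ(Dᵏ, ∂Dᵏ) = (-1)^k rank M`) and `∂Dᵏ` (`χ = (1 - (-1)^k) rank M`, by
the exact sequence of the pair), transported along homeomorphisms *across universes*
(`…UniverseTransportIso`, `FinRelHomology.of_homeomorph`); one attached cell `(D', S')` and `(Y ∪ D', Y)`
(`IsAttachedCell.finRelHomology_range/union`); induction on the cells.

Coefficients: `R` a Noetherian domain (so that rank–nullity `HasRankNullity` holds in every
universe, e.g. `ℤ` or a field), `M` a finitely generated `R`-module.  Everything is proved; there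
are no definitions.

## References

* A. Hatcher, *Algebraic Topology*, CUP 2002, §2.1 p. 118, Example 2.17, Lemma 2.34 (a),
  Thm. 2.44. [HatcherAT2002]
* J. Milnor, *Lectures on the h-cobordism theorem*, Princeton 1965, Remark after Thm. 3.14 and
  Cor. 3.15 (PDF pp. 19–21). [MilnorHCobordism1965]
-/

noncomputable section

open CategoryTheory Limits Set Metric Function

universe u v w

namespace Literature.AlgebraicTopology.SingularHomology

variable (R : Type v) [CommRing R] (M : Type v) [AddCommGroup M] [Module R M]

/-- `rank_R (ULift M) = rank_R M`. [folklore] -/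
theorem finrank_ulift : Module.finrank R (ULift.{w} M) = Module.finrank R M :=
  ULift.moduleEquiv.finrank_eq

/-! ### Contractible spaces: `χ(X) = rank M` -/

section Contractible

variable {X : Type u} [TopologicalSpace X]

/-- `rank H₀(X; M) = rank M` for a nonempty path-connected space (Hatcher 2002, Prop. 2.7:
`ε : H₀(X) ≅ M`). [cite: HatcherAT2002, Prop. 2.7] -/
theorem finrank_singularHomology_zero_of_pathConnectedSpace [PathConnectedSpace X] :
    Module.finrank R (singularHomology R M X 0) = Module.finrank R M := by
  haveI := singularHomology.isIso_ε_of_pathConnectedSpace R M (X := X)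
  rw [(asIso (singularHomology.ε R M X)).toLinearEquiv.finrank_eq]
  exact finrank_ulift R M

/-- `H₀(X; M)` is finitely generated for a nonempty path-connected space and finitely generated
`M` (Hatcher 2002, Prop. 2.7). [cite: HatcherAT2002, Prop. 2.7] -/
theorem finite_singularHomology_zero_of_module_finite [PathConnectedSpace X]
    [Module.Finite R M] : Module.Finite R (singularHomology R M X 0) := by
  haveI := singularHomology.isIso_ε_of_pathConnectedSpace R M (X := X)
  haveI : Module.Finite R (ULift.{u} M) := Module.Finite.equiv ULift.moduleEquiv.symm
  exact Module.Finite.equiv (asIso (singularHomology.ε R M X)).toLinearEquiv.symm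

/-- **A contractible space has finitely generated homology concentrated in degree `0`**
(Hatcher 2002, Prop. 2.7 and Ex. 2.11 / homotopy invariance). [cite: HatcherAT2002, Prop. 2.7] -/
theorem finRelHomology_empty_of_contractibleSpace [ContractibleSpace X] [Module.Finite R M] :
    FinRelHomology R M X ∅ 1 := by
  refine FinRelHomology.empty_of_absolute (fun k => ?_) fun k hk =>
    isZero_singularHomology_of_contractibleSpace R M (by omega)
  cases k with
  | zero => exact finite_singularHomology_zero_of_module_finite R M
  | succ k => exact finite_of_isZero (isZero_singularHomology_of_contractibleSpace R M k.succ_ne_zero)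

/-- **`χ(X) = rank M` for a contractible space** (Matsumoto 2002, §4.1: `χ(Dᵐ) = χ(point) = 1`;
Hatcher 2002, Prop. 2.7). [cite: HatcherAT2002, Prop. 2.7] -/
theorem relEuler_empty_of_contractibleSpace [ContractibleSpace X] [Module.Finite R M] [Nontrivial R] :
    relEuler R M X ∅ = Module.finrank R M := by
  rw [(finRelHomology_empty_of_contractibleSpace R M).relEuler_empty_eq_sum, Finset.sum_range_one,
    finrank_singularHomology_zero_of_pathConnectedSpace]
  simp

end Contractible

/-! ### The models: `(Dᵏ, ∂Dᵏ)` and `∂Dᵏ` -/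

section Ball

/-- **`H_k(Dᵏ, ∂Dᵏ; M) ≃ₗ[R] M`** for every `k ≥ 0` (Hatcher 2002, Example 2.17; for `k = 0`,
`∂D⁰ = ∅` and `H₀(D⁰) ≅ M` by Prop. 2.7), assembled from the tree's
`relativeSingularHomologyClosedBallOneIso` (`k = 1`), `relativeSingularHomologyClosedBallIso`
(`k ≥ 2`) and the augmentation (`k = 0`). [cite: HatcherAT2002, Example 2.17 (p. 118)] -/
theorem nonempty_relativeSingularHomology_closedBall_sphere_equiv : ∀ k : ℕ,
    Nonempty (relativeSingularHomology R M ↥(closedBall (0 : EuclideanSpace ℝ (Fin k)) 1)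
      (Subtype.val ⁻¹' sphere (0 : EuclideanSpace ℝ (Fin k)) 1) k ≃ₗ[R] M)
  | 0 => by
    haveI := isEmpty_boundarySphere_zero
    haveI := relativeSingularHomology.isIso_ofAbsolute_of_isEmpty R M
      (X := ↥(closedBall (0 : EuclideanSpace ℝ (Fin 0)) 1))
      (Subtype.val ⁻¹' sphere (0 : EuclideanSpace ℝ (Fin 0)) 1) 0
    haveI := pathConnectedSpace_closedBall 0
    haveI := singularHomology.isIso_ε_of_pathConnectedSpace R M
      (X := ↥(closedBall (0 : EuclideanSpace ℝ (Fin 0)) 1))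
    exact ⟨(asIso (relativeSingularHomology.ofAbsolute R M ↥(closedBall (0 : EuclideanSpace ℝ (Fin 0)) 1)
        (Subtype.val ⁻¹' sphere (0 : EuclideanSpace ℝ (Fin 0)) 1) 0)).toLinearEquiv.symm ≪≫ₗ
      (asIso (singularHomology.ε R M ↥(closedBall (0 : EuclideanSpace ℝ (Fin 0)) 1))).toLinearEquiv ≪≫ₗ
        ULift.moduleEquiv⟩
  | 1 => ⟨(relativeSingularHomologyClosedBallOneIso R M).toLinearEquiv ≪≫ₗ ULift.moduleEquiv⟩
  | (m + 2) => ⟨(relativeSingularHomologyClosedBallIso R M m).toLinearEquiv ≪≫ₗ ULift.moduleEquiv⟩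

variable [Module.Finite R M]

/-- **`(Dᵏ, ∂Dᵏ)` has finitely generated homology concentrated in degree `k`** (Hatcher 2002,
Example 2.17). [cite: HatcherAT2002, Example 2.17 (p. 118)] -/
theorem finRelHomology_closedBall_sphere (k : ℕ) :
    FinRelHomology R M ↥(closedBall (0 : EuclideanSpace ℝ (Fin k)) 1)
      (Subtype.val ⁻¹' sphere (0 : EuclideanSpace ℝ (Fin k)) 1) (k + 1) := by
  refine ⟨fun j => ?_, fun j hj =>
    isZero_relativeSingularHomology_closedBall_sphere R M (show j ≠ k by omega)⟩
  by_cases hj : j = k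
  · subst hj
    obtain ⟨e⟩ := nonempty_relativeSingularHomology_closedBall_sphere_equiv R M j
    exact Module.Finite.equiv e.symm
  · exact finite_of_isZero (isZero_relativeSingularHomology_closedBall_sphere R M hj)

/-- **`χ(Dᵏ, ∂Dᵏ) = (-1)^k rank M`** (Hatcher 2002, Example 2.17). [cite: HatcherAT2002, Example 2.17 (p. 118)] -/
theorem relEuler_closedBall_sphere [Nontrivial R] (k : ℕ) :
    relEuler R M ↥(closedBall (0 : EuclideanSpace ℝ (Fin k)) 1)
      (Subtype.val ⁻¹' sphere (0 : EuclideanSpace ℝ (Fin k)) 1) = (-1 : ℤ) ^ k * Module.finrank R M := by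
  rw [(finRelHomology_closedBall_sphere R M k).relEuler_eq_sum, Finset.sum_eq_single k]
  · obtain ⟨e⟩ := nonempty_relativeSingularHomology_closedBall_sphere_equiv R M k
    rw [e.finrank_eq]
  · intro j _ hjk
    rw [finrank_eq_zero_of_isZero (isZero_relativeSingularHomology_closedBall_sphere R M hjk),
      Nat.cast_zero, mul_zero]
  · intro hk
    exact absurd (Finset.mem_range.2 (Nat.lt_succ_self k)) hk

variable [IsNoetherianRing R] [IsDomain R]

/-- **The boundary sphere `∂Dᵏ ⊆ Dᵏ`: finitely generated homology, bounded by `k + 1`, and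
`χ(∂Dᵏ) = (1 - (-1)^k) · rank M`** (Hatcher 2002, Cor. 2.14 and Example 2.17: from
`χ(Dᵏ) = χ(∂Dᵏ) + χ(Dᵏ, ∂Dᵏ)` along the exact sequence of the pair; `∂D⁰ = ∅`).
[cite: HatcherAT2002, Example 2.17 (p. 118), with Cor. 2.14] -/
theorem finRelHomology_boundarySphere (k : ℕ) :
    FinRelHomology R M ↥(Subtype.val ⁻¹' sphere (0 : EuclideanSpace ℝ (Fin k)) 1 :
        Set ↥(closedBall (0 : EuclideanSpace ℝ (Fin k)) 1)) ∅ (k + 1) ∧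
      relEuler R M ↥(Subtype.val ⁻¹' sphere (0 : EuclideanSpace ℝ (Fin k)) 1 :
        Set ↥(closedBall (0 : EuclideanSpace ℝ (Fin k)) 1)) ∅ =
        Module.finrank R M - (-1 : ℤ) ^ k * Module.finrank R M := by
  -- the ball `D`, its boundary sphere `S ⊆ D`
  set D : Set (EuclideanSpace ℝ (Fin k)) := closedBall 0 1 with hD
  set S : Set ↥D := Subtype.val ⁻¹' sphere (0 : EuclideanSpace ℝ (Fin k)) 1 with hS
  haveI : ContractibleSpace ↥D := contractibleSpace_closedBall k
  have hX : FinRelHomology R M ↥D ∅ (k + 1) :=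
    (finRelHomology_empty_of_contractibleSpace R M).mono (by omega)
  obtain ⟨hA, hχ⟩ := FinRelHomology.triple_left (M := M) (empty_subset S) hX
    (finRelHomology_closedBall_sphere R M k)
  refine ⟨hA.congr_set (Set.preimage_empty), ?_⟩
  rw [← relEuler_congr_set (Set.preimage_empty (f := (Subtype.val : ↥S → ↥D)))]
  rw [relEuler_empty_of_contractibleSpace R M, relEuler_closedBall_sphere] at hχ
  linarith

/-- The sphere data transported to any space homeomorphic to `∂Dᵏ`, in any universe.
[cite: HatcherAT2002, Example 2.17 (p. 118), with Cor. 2.14] -/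
theorem finRelHomology_of_homeomorph_boundarySphere {k : ℕ} {S : Type u} [TopologicalSpace S]
    (e : ↥(Subtype.val ⁻¹' sphere (0 : EuclideanSpace ℝ (Fin k)) 1 :
      Set ↥(closedBall (0 : EuclideanSpace ℝ (Fin k)) 1)) ≃ₜ S) :
    FinRelHomology R M S ∅ (k + 1) ∧
      relEuler R M S ∅ = Module.finrank R M - (-1 : ℤ) ^ k * Module.finrank R M := by
  obtain ⟨h, hχ⟩ := finRelHomology_boundarySphere R M k
  exact ⟨h.of_homeomorph e (Set.mapsTo_empty _ _) (Set.mapsTo_empty _ _),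
    (relEuler_eq_of_homeomorph e (Set.mapsTo_empty _ _) (Set.mapsTo_empty _ _)).symm.trans hχ⟩

end Ball

/-! ### One attached cell -/

section Cell

variable {Z : Type u} [TopologicalSpace Z] [T2Space Z] {Y : Set Z} {k : ℕ}
  {Φ : C(↥(closedBall (0 : EuclideanSpace ℝ (Fin k)) 1), Z)}
variable [Module.Finite R M] [IsNoetherianRing R] [IsDomain R]

/-- **The embedded cell pair `(D', S') = (Φ(Dᵏ), Φ(Dᵏ) ∩ Y)`: finitely generated homology
concentrated in degree `k`, with `χ(D', S') = (-1)^k rank M`** (Hatcher 2002, Example 2.17 rerun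
on the embedded pair: `D'` is contractible, `S' ≅ ∂Dᵏ` across universes, and
`χ(D') = χ(S') + χ(D', S')`; Milnor 1965, Cor. 3.15). [cite: HatcherAT2002, Example 2.17 (p. 118)] -/
theorem IsAttachedCell.finRelHomology_range (h : IsAttachedCell Y Φ) :
    FinRelHomology R M ↥(range Φ) (Subtype.val ⁻¹' Y) (k + 1) ∧
      relEuler R M ↥(range Φ) (Subtype.val ⁻¹' Y) = (-1 : ℤ) ^ k * Module.finrank R M := by
  -- the sphere `S'`
  obtain ⟨hS, hχS⟩ := finRelHomology_of_homeomorph_boundarySphere R M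
    ((boundarySphereHomeomorph k).trans h.sphereHomeomorph)
  -- the disc `D'`
  haveI := h.contractibleSpace_range
  have hD : FinRelHomology R M ↥(range Φ) ∅ (k + 1) :=
    (finRelHomology_empty_of_contractibleSpace R M).mono (by omega)
  have hχD : relEuler R M ↥(range Φ) ∅ = Module.finrank R M :=
    relEuler_empty_of_contractibleSpace R M
  -- the pair, from the triple `(D', S', ∅)`
  obtain ⟨hDS, hχ⟩ := FinRelHomology.triple_right (M := M)
    (empty_subset (Subtype.val ⁻¹' Y : Set ↥(range Φ))) (hS.congr_set Set.preimage_empty.symm) hD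
  have hfin : FinRelHomology R M ↥(range Φ) (Subtype.val ⁻¹' Y) (k + 1) :=
    ⟨hDS.finite, fun j hj => h.isZero_relativeSingularHomology_range R M (show j ≠ k by omega)⟩
  refine ⟨hfin, ?_⟩
  rw [hχD, relEuler_congr_set (Set.preimage_empty (f := (Subtype.val :
      ↥(Subtype.val ⁻¹' Y : Set ↥(range Φ)) → ↥(range Φ)))), hχS] at hχ
  linarith

/-- **`(Y ∪ D', Y)` for one attached `k`-cell: finitely generated homology concentrated in degree
`k`, with `χ(Y ∪ D', Y) = (-1)^k rank M`** (Hatcher 2002, Lemma 2.34 (a) for one cell; Milnor 1965,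
Cor. 3.15 with Thm. 3.14), by `IsAttachedCell.relativeSingularHomologyIso`.
[cite: HatcherAT2002, Lemma 2.34 (a)] -/
theorem IsAttachedCell.finRelHomology_union (h : IsAttachedCell Y Φ) :
    FinRelHomology R M ↥(Y ∪ range Φ) (Subtype.val ⁻¹' Y) (k + 1) ∧
      relEuler R M ↥(Y ∪ range Φ) (Subtype.val ⁻¹' Y) = (-1 : ℤ) ^ k * Module.finrank R M := by
  obtain ⟨h1, h2⟩ := h.finRelHomology_range R M
  exact ⟨h1.of_iso fun j => h.relativeSingularHomologyIso R M j,
    (relEuler_eq_of_iso fun j => h.relativeSingularHomologyIso R M j).symm.trans h2⟩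

/-- One step of the induction: attaching one more `k`-cell `Φ` to the closed set `B ⊇ S₁` (met
by `Φ` exactly along its boundary sphere) adds `(-1)^k rank M` to `χ(·, S₁)` and preserves
finite generation and the bound (exact sequence of the triple `(B ∪ D', B, S₁)`, Hatcher 2002,
§2.1 p. 118, and Lemma 2.34 (a)). [cite: HatcherAT2002, §2.1, p. 118 (exact sequence of a triple) and Lemma 2.34 (a)] -/
theorem finRelHomology_union_range_step {S₁ B : Set Z} (hSB : S₁ ⊆ B) (hcell : IsAttachedCell B Φ)
    {N : ℕ} (hk : k < N) {χ : ℤ} (hB : FinRelHomology R M ↥B (Subtype.val ⁻¹' S₁) N)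
    (hχ : relEuler R M ↥B (Subtype.val ⁻¹' S₁) = χ) :
    FinRelHomology R M ↥(B ∪ range Φ) (Subtype.val ⁻¹' S₁) N ∧
      relEuler R M ↥(B ∪ range Φ) (Subtype.val ⁻¹' S₁) = χ + (-1 : ℤ) ^ k * Module.finrank R M := by
  have hsub : (Subtype.val ⁻¹' S₁ : Set ↥(B ∪ range Φ)) ⊆ Subtype.val ⁻¹' B := fun _ hz => hSB hz
  -- the pair `(B, S₁)` realised on the subtype `↥(B ∪ D') ↓∩ B`
  set e := (preimageValHomeomorphOfSubset (subset_union_left : B ⊆ B ∪ range Φ)).symm with he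
  have hto : MapsTo e (Subtype.val ⁻¹' S₁ : Set ↥B)
      (Subtype.val ⁻¹' (Subtype.val ⁻¹' S₁ : Set ↥(B ∪ range Φ)) :
        Set ↥(Subtype.val ⁻¹' B : Set ↥(B ∪ range Φ))) := fun _ hz => hz
  have hfrom : MapsTo e.symm
      (Subtype.val ⁻¹' (Subtype.val ⁻¹' S₁ : Set ↥(B ∪ range Φ)) :
        Set ↥(Subtype.val ⁻¹' B : Set ↥(B ∪ range Φ)))
      (Subtype.val ⁻¹' S₁ : Set ↥B) := fun _ hz => hz
  have hAB := hB.of_homeomorph e hto hfrom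
  have hχAB : relEuler R M ↥(Subtype.val ⁻¹' B : Set ↥(B ∪ range Φ))
      (Subtype.val ⁻¹' (Subtype.val ⁻¹' S₁ : Set ↥(B ∪ range Φ))) = χ := by
    rw [← hχ]
    exact (relEuler_eq_of_homeomorph e hto hfrom).symm
  -- the pair `(B ∪ D', B)`
  obtain ⟨hXA, hχXA⟩ := hcell.finRelHomology_union R M
  obtain ⟨hres, hχres⟩ := FinRelHomology.triple_mid hsub hAB (hXA.mono hk)
  refine ⟨hres, ?_⟩
  rw [hχres, hχAB, hχXA]

end Cell

/-! ### Finitely many disjoint cells -/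

section Cells

variable {Z : Type u} [TopologicalSpace Z] [T2Space Z] {ι : Type*} {d : ι → ℕ}
variable [Module.Finite R M] [IsNoetherianRing R] [IsDomain R]

/-- **`χ(S₁ ∪ ⋃ᵢ Φᵢ(D^{dᵢ}), S₁) = (Σᵢ (-1)^{dᵢ}) · rank M`**, the homology of the pair being
finitely generated and zero from degree `N > max dᵢ` on: finitely many closed cells with pairwise
disjoint images attached to a closed subset `S₁` of a Hausdorff space along their boundary
spheres (`Φᵢ x ∈ S₁ ↔ ‖x‖ = 1`) (Hatcher 2002, Lemma 2.34 (a) with the proof of Thm. 2.44, for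
cells on a closed set; the rank form of Milnor 1965, Remark after Thm. 3.14 with Cor. 3.15:
*"`H⁎(W, V)` is isomorphic to `ℤ ⊕ … ⊕ ℤ` (`k` summands) in dimension `λ` and is zero
otherwise"*).  Proof: attach the cells one at a time (`finRelHomology_union_range_step`).
[cite: HatcherAT2002, Lemma 2.34 (a) (p. 137) and Thm. 2.44; MilnorHCobordism1965, Remark after Thm. 3.14 and Cor. 3.15 (PDF pp. 19–21)] -/
theorem finRelHomology_union_iUnion_range [Fintype ι] {S₁ : Set Z} (hS₁ : IsClosed S₁)
    (Φ : ∀ i, C(↥(closedBall (0 : EuclideanSpace ℝ (Fin (d i))) 1), Z)) (hmem : ∀ i x, Φ i x ∈ S₁ ↔ ‖(x : EuclideanSpace ℝ (Fin (d i)))‖ = 1)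
    (hinj : ∀ i, Injective (Φ i))
    (hdisj : Pairwise fun i i' => Disjoint (range (Φ i)) (range (Φ i'))) {N : ℕ}
    (hN : ∀ i, d i < N) :
    FinRelHomology R M ↥(S₁ ∪ ⋃ i, range (Φ i)) (Subtype.val ⁻¹' S₁) N ∧
      relEuler R M ↥(S₁ ∪ ⋃ i, range (Φ i)) (Subtype.val ⁻¹' S₁) =
        (∑ i, (-1 : ℤ) ^ (d i)) * Module.finrank R M := by
  classical
  -- the partial unions `B T = S₁ ∪ ⋃ i ∈ T, Φᵢ(D)`
  let B : Finset ι → Set Z := fun T => S₁ ∪ ⋃ i ∈ T, range (Φ i)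
  have hSB : ∀ T, S₁ ⊆ B T := fun T => subset_union_left
  have hBcl : ∀ T, IsClosed (B T) := fun T =>
    hS₁.union (T.finite_toSet.isClosed_biUnion fun i _ => isClosed_range_of_injective (Φ i) (hinj i))
  -- attaching the cell `Φ i`, `i ∉ T`, to `B T`
  have hcell : ∀ (T : Finset ι) (i : ι), i ∉ T → IsAttachedCell (B T) (Φ i) := by
    intro T i hi
    refine ⟨hBcl T, hinj i, fun x => ⟨fun hx => ?_, fun hx => hSB T ((hmem i x).mpr hx)⟩⟩
    rcases hx with hx | hx
    · exact (hmem i x).mp hx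
    · simp only [mem_iUnion, exists_prop] at hx
      obtain ⟨i', hi', hx⟩ := hx
      have hne : i ≠ i' := fun h => hi (h ▸ hi')
      exact absurd (mem_range_self (f := Φ i) x) (disjoint_left.mp (hdisj hne) · hx)
  have hBins : ∀ (T : Finset ι) (i : ι), B (insert i T) = B T ∪ range (Φ i) := by
    intro T i
    change S₁ ∪ ⋃ i' ∈ insert i T, range (Φ i') = (S₁ ∪ ⋃ i' ∈ T, range (Φ i')) ∪ range (Φ i)
    rw [Finset.set_biUnion_insert, union_assoc, union_comm (range (Φ i))]
  -- induction on `T`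
  have hind : ∀ T : Finset ι,
      FinRelHomology R M ↥(B T) (Subtype.val ⁻¹' S₁) N ∧
        relEuler R M ↥(B T) (Subtype.val ⁻¹' S₁) =
          (∑ i ∈ T, (-1 : ℤ) ^ (d i)) * Module.finrank R M := by
    intro T
    induction T using Finset.induction_on with
    | empty =>
      have hB0 : B ∅ = S₁ := by
        change S₁ ∪ ⋃ i ∈ (∅ : Finset ι), range (Φ i) = S₁
        ext z
        simp
      rw [hB0, Finset.sum_empty, zero_mul]
      exact ⟨(FinRelHomology.preimage_self S₁).mono (Nat.zero_le N), relEuler_preimage_self S₁⟩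
    | insert i T hi ih =>
      rw [hBins T i, Finset.sum_insert hi, add_comm, add_mul]
      exact finRelHomology_union_range_step R M (hSB T) (hcell T i hi) (hN i) ih.1 ih.2
  have huniv : B Finset.univ = S₁ ∪ ⋃ i, range (Φ i) := by
    change S₁ ∪ ⋃ i ∈ (Finset.univ : Finset ι), range (Φ i) = S₁ ∪ ⋃ i, range (Φ i)
    congr 1
    ext z
    simp
  rw [← huniv]
  exact hind Finset.univ

end Cells

end Literature.AlgebraicTopology.SingularHomology
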